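/-
Origin: expansion seat `planner-pub-hodgecm-pv09-0`, handover 2026-08-18T03:50:29Z (`HOME/pub-hodgecm-pv09/lean/Pv09/P36UnfoldStep1.lean`, md5 56717558, 197 lines);
landed by the gen-5 packager in gate run 20 as `HodgeCM/PerL34/P36UnfoldStep1.lean` (import ^import Pv[0-9]+\.→import HodgeCM.PerL34. ×1).
-/
/-
pub-hodgecm speedrun cell, prover pv09 — WIP module `Pv09.P36UnfoldStep1` (landing target
`HodgeCM/PerL34/P36UnfoldStep1.lean`).  Imports `Pv09.RallisUnfold` (→ `HodgeCM.PerL34.RallisUnfold`).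

# Prop 3.6, Step 1 — the UNFOLDING IDENTITY (PerL v5 tex ll. 413–417), kernel-proved in the
fundamental-domain model.  This is the residual INPUT `Step1Data.UnfoldingIdentity` of pv14's N23b split
(`P36Unfolding.lean`): "Unfolding, 𝒯_Φ(E^χ_f) = ∫_{T(L₀)\U(W)(𝔸)} θ_Φ(·,y) Ξ^χ_f(y) dy
 = ∫_{U(W)(𝔸)} f(h) ϑ_{T,χ}(ω(h)Φ) dh" (l. 415–417), with "θ_{ω(h)Φ}(g,y) = θ_Φ(g,yh)" (l. 418).

MODEL (LEMMAS §3 D7 made concrete, as in `RallisUnfold`): `U` = U(W)(𝔸) with left Haar measure `μ`;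
`Γ` = U(W)(L₀) ≤ U, countable, acting by left multiplication, `𝓕` a measurable fundamental domain, so that
`∫_{[U(W)]} F = ∫_𝓕 F dμ` for left-Γ-invariant `F`; `T` = T(𝔸) an abstract group with Haar measure `ν` and a
measurable hom `jT : T →* U`; `Γ_T` = T(L₀) = `Γ.comap jT`, `𝓕T ⊆ T` a fundamental domain for it, so that
`∫_{[T]} = ∫_{𝓕T} dν`; `θ = θ_Φ(g,·)` (fixed g) a left-Γ-invariant function on U; `χ` a function on T invariant
under Γ_T; `f` the test function.  PerL's `Ξ^χ_f(y) = ∫_{T(𝔸)} f(t⁻¹y)χ(t)dt` (l. 409) is `Xi`, and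
`Ψ(z) := ∫_{𝓕T} f(t⁻¹z)χ(t)dν` its one-fundamental-domain piece, `Ξ(z) = Σ_{τ∈Γ_T} Ψ(τ⁻¹z)` (`Xi_unfold`).
PerL's `E^χ_f(y) = Σ_{γ∈T(L₀)\U(W)(L₀)} Ξ(γy)` regroups (τ,γ) ↦ τ⁻¹γ into the FULL sum `E(y) = Σ_{γ∈Γ} Ψ(γy)`
(`tsum_regroup` is the abstract regrouping `Σ_Γ G = Σ_{Γ/Δ} Σ_Δ G(q.out·s)`); the theorem
`unfolding_identity` is stated with `E` as that full Γ-sum (hypothesis `hE`, a `HasSum`).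

THEOREM `unfolding_identity` (scalar, at a fixed g):
  ∫_𝓕 θ(y) E(y) dμ(y) = ∫_U f(h) · ( ∫_{𝓕T} θ(jT t · h) χ(t) dν(t) ) dμ(h),
i.e. 𝒯_Φ(E^χ_f)(g) = ∫_{U(W)(𝔸)} f(h) ϑ_{T,χ}(ω(h)Φ)(g) dh with ϑ_{T,χ}(ω(h)Φ)(g) = ∫_{[T]} θ_Φ(g,th)χ(t)dt.
Its only analytic hypothesis is the absolute convergence `hint` (integrability of
(z,t) ↦ θ(z) f(t⁻¹z) χ(t) on U × 𝓕T; in PerL: θ_Φ bounded continuous, f ∈ C_c, [T] compact).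
`bochner_upgrade` turns the pointwise identity (all g ∈ [G_U]) into pv14's `C([G_U])`/Hilbert-valued form
`TΦ(E) = ∫ f h • ϑ(ω(h)Φ) dh` (evaluation commutes with the Bochner integral).
-/
import Summits.HodgeConjecture.HodgeCM.PerL34.RallisUnfold

/-! PORT of `HodgeCM/PerL34/P36UnfoldStep1.lean` (HodgeCMPerL run 81) — verbatim mechanical port; provenance in the PORT header line. -/

set_option autoImplicit false

open MeasureTheory Complex ComplexConjugate
open scoped Pointwise

namespace HodgeCM.PerL34.P36Unfold

section Scalar

variable {U : Type*} [Group U] [MeasurableSpace U] [MeasurableMul₂ U]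
  {T : Type*} [Group T] [MeasurableSpace T] [MeasurableMul₂ T]

/-- `Ψ(z) := ∫_{𝓕T} f(t⁻¹ z) χ(t) dν(t)` — one fundamental-domain piece of PerL's `Ξ^χ_f`. -/
noncomputable def Psi (ν : Measure T) (jT : T →* U) (𝓕T : Set T) (f : U → ℂ) (χ : T → ℂ) (z : U) : ℂ :=
  ∫ t in 𝓕T, f ((jT t)⁻¹ * z) * χ t ∂ν

/-- `Ξ^χ_f(z) := ∫_{T(𝔸)} f(t⁻¹ z) χ(t) dt` (tex l. 409). -/
noncomputable def Xi (ν : Measure T) (jT : T →* U) (f : U → ℂ) (χ : T → ℂ) (z : U) : ℂ :=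
  ∫ t, f ((jT t)⁻¹ * z) * χ t ∂ν

/-- `ϑ_{T,χ}(ω(h)Φ)(g) = ∫_{[T]} θ_Φ(g, t h) χ(t) dt` (tex l. 346 with l. 418), `[T]`-integral = `∫_{𝓕T} dν`. -/
noncomputable def thetaPeriod (ν : Measure T) (jT : T →* U) (𝓕T : Set T) (θ : U → ℂ) (χ : T → ℂ) (h : U) : ℂ :=
  ∫ t in 𝓕T, θ (jT t * h) * χ t ∂ν

omit [MeasurableSpace U] [MeasurableMul₂ U] in
/-- **Unfolding of `Ξ` over `T(L₀)`** (first half of "Unfolding", l. 415): if `χ` is left-`Γ_T`-invariant and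
`𝓕T` is a fundamental domain for `Γ_T = Γ.comap jT` acting on `T`, then
`Ξ(z) = Σ_{τ ∈ Γ_T} Ψ((jT τ)⁻¹ z)`. -/
theorem Xi_unfold (ν : Measure T) [ν.IsMulLeftInvariant] (jT : T →* U) (Γ : Subgroup U)
    [Countable (Γ.comap jT)] {𝓕T : Set T} (h𝓕T : IsFundamentalDomain (Γ.comap jT) 𝓕T ν)
    (f : U → ℂ) (χ : T → ℂ) (hχ : ∀ τ : Γ.comap jT, ∀ t, χ ((τ : T) * t) = χ t) (z : U)
    (hFz : Integrable (fun t => f ((jT t)⁻¹ * z) * χ t) ν) :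
    Xi ν jT f χ z = ∑' τ : Γ.comap jT, Psi ν jT 𝓕T f χ ((jT (τ : T))⁻¹ * z) := by
  unfold Xi Psi
  rw [h𝓕T.integral_eq_tsum'' _ hFz]
  refine tsum_congr fun τ => ?_
  congr 1
  funext t
  rw [Subgroup.smul_def, smul_eq_mul, hχ τ t, map_mul, mul_inv_rev, mul_assoc]

/-- `(Γ/Δ) × Δ ≃ Γ`, `(q, s) ↦ q.out · s` (explicit version of `Subgroup.groupEquivQuotientProdSubgroup`). -/
noncomputable def quotientProdEquiv {Γ : Type*} [Group Γ] (Δ : Subgroup Γ) : (Γ ⧸ Δ) × Δ ≃ Γ where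
  toFun p := p.1.out * p.2
  invFun γ := ((γ : Γ ⧸ Δ), ⟨(γ : Γ ⧸ Δ).out⁻¹ * γ, QuotientGroup.eq.mp (QuotientGroup.out_eq' _)⟩)
  left_inv p := by
    obtain ⟨q, s⟩ := p
    have hq : ((q.out * (s : Γ) : Γ) : Γ ⧸ Δ) = q := by
      rw [← QuotientGroup.out_eq' q, eq_comm]
      refine QuotientGroup.eq.mpr ?_
      rw [QuotientGroup.out_eq', inv_mul_cancel_left]
      exact s.2
    refine Prod.ext hq (Subtype.ext ?_)
    simp only [hq, inv_mul_cancel_left]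
  right_inv γ := by simp only [mul_inv_cancel_left]

/-- Abstract regrouping of a `Γ`-sum along a subgroup `Δ ≤ Γ`: `Σ_{γ∈Γ} G(γ) = Σ_{q ∈ Γ/Δ} Σ_{s∈Δ} G(q.out·s)`
(for PerL: `Σ_{γ} Ψ(γ⁻¹y) = Σ_{q} Ξ(q.out⁻¹ y)`, i.e. `E^χ_f(y) = Σ_{T(L₀)\U(W)(L₀)} Ξ(γ y)` after `γ ↦ γ⁻¹`,
which exchanges right cosets `T(L₀)γ` and left cosets `γ⁻¹T(L₀)`). -/
theorem tsum_regroup {Γ : Type*} [Group Γ] (Δ : Subgroup Γ) (G : Γ → ℂ) (hG : Summable G) :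
    ∑' γ, G γ = ∑' q : Γ ⧸ Δ, ∑' s : Δ, G (q.out * s) := by
  rw [← Equiv.tsum_eq (quotientProdEquiv Δ) G]
  have hG' : Summable fun p : (Γ ⧸ Δ) × Δ => G (quotientProdEquiv Δ p) :=
    (Equiv.summable_iff (quotientProdEquiv Δ)).mpr hG
  rw [hG'.tsum_prod]
  rfl

omit [MeasurableMul₂ T] in
/-- **The unfolding identity, Prop 3.6 Step 1** (tex ll. 414–417), at a fixed `g`:
`∫_{[U(W)]} θ_Φ(g,y) E^χ_f(y) dy = ∫_{U(W)(𝔸)} f(h) ϑ_{T,χ}(ω(h)Φ)(g) dh`.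
Hypotheses: `θ` left-`Γ`-invariant (`θ_Φ(g,·)` is a function on `[U(W)]`), `E = Σ_{γ∈Γ} Ψ(γ·)` (PerL's `E^χ_f`,
see the module docstring), and absolute convergence `hint`. -/
theorem unfolding_identity (μ : Measure U) [μ.IsMulLeftInvariant] [SFinite μ]
    (ν : Measure T) [SFinite ν] (jT : T →* U) (hjT : Measurable jT)
    (Γ : Subgroup U) [Countable Γ] {𝓕 : Set U} (h𝓕 : IsFundamentalDomain Γ 𝓕 μ) (𝓕T : Set T)
    (θ f : U → ℂ) (χ : T → ℂ) (E : U → ℂ)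
    (hθ : ∀ γ : Γ, ∀ z, θ ((γ : U) * z) = θ z)
    (hE : ∀ y, HasSum (fun γ : Γ => Psi ν jT 𝓕T f χ ((γ : U) * y)) (E y))
    (hint : Integrable (fun p : U × T => θ p.1 * (f ((jT p.2)⁻¹ * p.1) * χ p.2)) (μ.prod (ν.restrict 𝓕T))) :
    ∫ y in 𝓕, θ y * E y ∂μ = ∫ h, f h * thetaPeriod ν jT 𝓕T θ χ h ∂μ := by
  -- the integrand `G(z,t) = θ(z) f(t⁻¹z) χ(t)` on `U × 𝓕T`
  set G : U × T → ℂ := fun p => θ p.1 * (f ((jT p.2)⁻¹ * p.1) * χ p.2) with hGdef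
  -- (1) `θ Ψ` is integrable on `U` and `θ(y) E(y) = Σ_γ (θΨ)(γ⁻¹ • y)`
  have hF : Integrable (fun z => θ z * Psi ν jT 𝓕T f χ z) μ := by
    have := hint.integral_prod_left
    refine this.congr (ae_of_all _ fun z => ?_)
    show ∫ t, G (z, t) ∂(ν.restrict 𝓕T) = θ z * Psi ν jT 𝓕T f χ z
    simp only [hGdef, Psi]
    exact integral_const_mul _ _
  have hsum : ∀ y, θ y * E y = ∑' γ : Γ, (fun z => θ z * Psi ν jT 𝓕T f χ z) (γ⁻¹ • y) := by
    intro y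
    rw [← (Equiv.tsum_eq (Equiv.inv Γ) (fun γ : Γ => (fun z => θ z * Psi ν jT 𝓕T f χ z) (γ⁻¹ • y)))]
    simp only [Equiv.inv_apply, inv_inv, Subgroup.smul_def, smul_eq_mul]
    rw [(hE y).tsum_eq.symm, ← tsum_mul_left]
    exact tsum_congr fun γ => by rw [hθ γ y]
  have h1 : ∫ y in 𝓕, θ y * E y ∂μ = ∫ z, θ z * Psi ν jT 𝓕T f χ z ∂μ := by
    rw [← HodgeCM.PerL34.RallisIP.setIntegral_tsum_eq_integral h𝓕 hF]
    exact setIntegral_congr_fun₀ h𝓕.nullMeasurableSet fun y _ => hsum y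
  rw [h1]
  -- (2) write `θ Ψ` as the inner integral of `G` and swap (Fubini)
  have h2 : ∫ z, θ z * Psi ν jT 𝓕T f χ z ∂μ = ∫ z, ∫ t, G (z, t) ∂(ν.restrict 𝓕T) ∂μ := by
    refine integral_congr_ae (ae_of_all _ fun z => ?_)
    show θ z * Psi ν jT 𝓕T f χ z = ∫ t, G (z, t) ∂(ν.restrict 𝓕T)
    simp only [hGdef, Psi]
    exact (integral_const_mul _ _).symm
  have hunc : (Function.uncurry fun z t => G (z, t)) = G := by funext p; rfl
  rw [h2, integral_integral_swap (by rw [hunc]; exact hint)]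
  -- (3) substitute `z = jT t · h` in the inner `U`-integral (left invariance of `μ`)
  have h3 : ∀ t : T, ∫ z, G (z, t) ∂μ = ∫ h, θ (jT t * h) * (f h * χ t) ∂μ := by
    intro t
    rw [← integral_mul_left_eq_self (fun z => G (z, t)) (jT t)]
    refine integral_congr_ae (ae_of_all _ fun h => ?_)
    show θ (jT t * h) * (f ((jT t)⁻¹ * (jT t * h)) * χ t) = θ (jT t * h) * (f h * χ t)
    rw [inv_mul_cancel_left]
  simp_rw [h3]
  -- (4) swap back; integrability of `(h,t) ↦ G(jT t · h, t)` from `hint` by the measure-preserving shear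
  set G' : U × T → ℂ := fun p => θ (jT p.2 * p.1) * (f p.1 * χ p.2) with hG'def
  have hshear : MeasurePreserving (fun p : T × U => (p.1, jT p.1 * p.2))
      ((ν.restrict 𝓕T).prod μ) ((ν.restrict 𝓕T).prod μ) := by
    refine (MeasurePreserving.id (ν.restrict 𝓕T)).skew_product (g := fun t h => jT t * h)
      ((hjT.comp measurable_fst).mul measurable_snd) (ae_of_all _ fun t => ?_)
    exact map_mul_left_eq_self μ (jT t)
  have hΦ : MeasurePreserving (fun p : U × T => (jT p.2 * p.1, p.2))
      (μ.prod (ν.restrict 𝓕T)) (μ.prod (ν.restrict 𝓕T)) :=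
    (Measure.measurePreserving_swap (μ := ν.restrict 𝓕T) (ν := μ)).comp
      (hshear.comp (Measure.measurePreserving_swap (μ := μ) (ν := ν.restrict 𝓕T)))
  have hint' : Integrable G' (μ.prod (ν.restrict 𝓕T)) := by
    have hcomp : G' = G ∘ fun p : U × T => (jT p.2 * p.1, p.2) := by
      funext p
      simp only [hG'def, hGdef, Function.comp_apply, inv_mul_cancel_left]
    rw [hcomp]
    exact (hΦ.integrable_comp hint.aestronglyMeasurable).mpr hint
  have hunc' : (Function.uncurry fun h t => θ (jT t * h) * (f h * χ t)) = G' := by funext p; rfl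
  rw [← integral_integral_swap (f := fun h t => θ (jT t * h) * (f h * χ t)) (by rw [hunc']; exact hint')]
  -- (5) pull `f(h)` out of the inner `[T]`-integral
  refine integral_congr_ae (ae_of_all _ fun h => ?_)
  show ∫ t in 𝓕T, θ (jT t * h) * (f h * χ t) ∂ν = f h * thetaPeriod ν jT 𝓕T θ χ h
  unfold thetaPeriod
  rw [← integral_const_mul]
  exact integral_congr_ae (ae_of_all _ fun t => by ring)

end Scalar

section Bochner

/-- **From pointwise to Bochner** (pv14's `UnfoldingIdentity` is `C([G_U])`/`L²`-valued): if `F : X → C(K,ℂ)`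
is Bochner-integrable and `G ∈ C(K,ℂ)` satisfies `G(g) = ∫ (F x)(g) dμ` for every `g`, then `G = ∫ F dμ`.
With `F h = f h • ϑ_{T,χ}(ω(h)Φ)` and `G = 𝒯_Φ(E^χ_f)` this is exactly the passage from `unfolding_identity`
(all `g`) to `TΦ (E χ f) = ∫ h, f h • ϑ χ (omg h Φ)`; composing with a CLM `C([G_U]) →L[ℂ] L²([G_U])` is
`ContinuousLinearMap.integral_comp_comm`. -/
theorem bochner_upgrade {X K : Type*} [MeasurableSpace X] (μ : Measure X) [TopologicalSpace K]
    [CompactSpace K] (F : X → C(K, ℂ)) (hF : Integrable F μ) (G : C(K, ℂ))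
    (hG : ∀ g : K, G g = ∫ x, F x g ∂μ) : G = ∫ x, F x ∂μ := by
  ext g
  rw [hG g]
  have := (ContinuousMap.evalCLM ℂ g : C(K, ℂ) →L[ℂ] ℂ).integral_comp_comm hF
  simpa using this

/-- The same pushed through a continuous linear map `ι : C(K,ℂ) →L[ℂ] H` (e.g. `C([G_U]) ⊂ L²([G_U])`). -/
theorem bochner_upgrade_clm {X K H : Type*} [MeasurableSpace X] (μ : Measure X) [TopologicalSpace K]
    [CompactSpace K] [NormedAddCommGroup H] [NormedSpace ℂ H] [CompleteSpace H] (ι : C(K, ℂ) →L[ℂ] H)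
    (F : X → C(K, ℂ)) (hF : Integrable F μ) (G : C(K, ℂ)) (hG : ∀ g : K, G g = ∫ x, F x g ∂μ) :
    ι G = ∫ x, ι (F x) ∂μ := by
  rw [bochner_upgrade μ F hF G hG, ι.integral_comp_comm hF]

end Bochner

end HodgeCM.PerL34.P36Unfold
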